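/-
Copyright: public-audit package `pub-balaban` (b2b-balaban), seat pv09-g4. Released under Apache 2.0 like Mathlib.
-/
import Literature.MathematicalPhysics.QuantumFieldTheory.Balaban1983to89.B6LayerTensor
import Literature.MathematicalPhysics.QuantumFieldTheory.Balaban1983to89.B4Block227

/-!
# B6, p. 245: a dimension-free window for the constant of the layer sentence — [8/L, 12/(L+1)]

Source under audit: T. Bałaban, *Propagators and renormalization transformations for lattice gauge theories.
II*, Commun. Math. Phys. **96** (1984) 223–250 [B6], proof of Lemma 2.4, p. 245.  Companion of
`B6Lemma24Kappa` (`LayerIneq d L κ`; admissible κ₀, κ₁ — both decaying with d), `B6LayerUpperBound`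
(`LayerIneq d L κ → κ ≤ 12/(L+1)`), `B6LayerRayleigh`/`B6LayerDimTwo`/`B6LayerTensor` (`LayerIneq d L 1 ↔ L ≤ 9`,
`LayerIneq d L κ ↔ PathIneq L κ` for every d ≥ 2: the layer inequality is one-dimensional), and a CONSUMER of
`B4Block227.poincare_path8` (cell B04, seat b04-g5: the canonical-path Poincaré inequality on the path `Fin (n+1)` with
constant (n+1)²/8) — imported untouched.

## The printed sentence (verbatim, p. 245, between (2.126) and (2.127))

*"The terms in parentheses on the right-hand side can be written as L^{−2}⟨B, (Δ_{Δ′}^{L^{−1},N} +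
Q′*_{Δ′}Q′_{Δ′})B⟩, where the operators are defined on a d − 1-dimensional lattice.  This quadratic form is
bounded from below by L^{−d−1} Σ_{x∈Δ′} |B_μ(x)|², hence"* [(2.127) follows].  (Same quotation as in
`B6LayerPoincare`, `B6LayerUpperBound`, `B6LayerRayleigh`, `B6LayerDimTwo`, `B6LayerTensor`; render re-read for this
file.)  The sentence is `LayerIneq d L 1`; it is false for L ≥ 10 and true for L ≤ 9 in every d ≥ 2 (`B6LayerTensor`).

## What this file proves (all [folklore]; nothing printed is asserted or used)

The question left by the companions is the SIZE of the admissible constant for the L of the paper (L large): the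
admissible constants of the B6 chain so far, κ₀ = 1/(4 + 6d(L−1)L^{d−2}) (`B6LayerPoincare`) and κ₁ = 2/(2 + (d−1)(L−1))
(`B6LayerPoincarePair`), decay with the dimension, while the only upper bound is 12/(L+1) (`B6LayerUpperBound`).  Since
the layer inequality IS the path inequality (`B6LayerTensor.layerIneq_iff_pathIneq`), the one-dimensional Poincaré
inequality settles the order of the constant in every dimension at once:

* `bond_sum_eq`, `var_le` — transport of `B4Block227.poincare_path8` (stated with `Beta.BlockPoincare.variance` /
  `dirichlet` on `Fin (n+1)`) to profiles `u : ℤ → ℝ` on [0, L) in the `PathIneq` format: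
  Σ_{[0,L)} (u − ū)² ≤ (L²/8) Σ_{a+1<L} (u(a+1) − u(a))².
* `pathIneq_of_mul_le` — hence `PathIneq L κ` for every κ ≤ 1 with κL ≤ 8 (variance identity
  `B6LayerTensor.sum_sq_eq_var_add`: the mean part is exactly the Q-term).
* `layerIneq_of_mul_le`, `layerIneq_lower` — for EVERY d ≥ 2 and L ≥ 1: **`LayerIneq d L (min 1 (8/L))`**; in
  particular `LayerIneq d L (8/L)` for L ≥ 8 (`layerIneq_eight_div`) — an admissible constant that does not decay
  with d, dominating κ₁ (`kappa1_le_eight_div`).  (A d-independent Poincaré constant on the FUNCTION CUBE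
  `Fin d → Fin (n+1)` is already `B4Block227.poincare_coordCube8` / `Beta.CoordCubePoincare.poincare_coordCube`; the
  present route to d-independence on the B6 face `lastLayer L y μ ⊂ (Fin d → ℤ)` is `B6LayerTensor`'s induction, which
  needs only the one-dimensional input.)
* `optimal_window` — with `B6LayerUpperBound.layerIneq_le`: for every d ≥ 2 and L ≥ 8 the optimal constant of the
  layer sentence lies in the d-INDEPENDENT window **[8/L, 12/(L+1)]**, of ratio 3L/(2(L+1)) < 3/2 (`window_ratio_lt`);
  `large_L_summary` records the three facts for L ≥ 10.  So the printed factor 1 must be replaced by a constant of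
  exact order 1/L, uniformly in the dimension.

## HONEST SCOPE

Nothing printed is asserted.  Nothing is said about the constant of (2.128) (printed 1/(12d²), numerically
supported, unproved — census G-B6-09R), whose printed derivation passes through this sentence: with a layer
constant of order 1/L the printed chain (2.126) → (2.127) → (2.128) yields an L-dependent constant only.  The sharp
value of the optimal constant, min(1, 4L sin²(π/2L)) (→ π²/L ≈ 9.87/L, inside the window), is not formalised.
-/

namespace Literature.MathematicalPhysics.QuantumFieldTheory.Balaban1983to89.B6LayerWindow

open Finset
open B6Lemma24Kappa (LayerIneq layerIneq_kappa1)
open B6LayerPoincarePair (kappa1)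
open B6LayerUpperBound (sum_Ico_int_eq_sum_range layerIneq_le)
open B6LayerDimTwo (PathIneq)
open B6LayerTensor (sum_Ico_const sum_sq_eq_var_add layerIneq_iff_pathIneq layerIneq_of_le_nine)
open Beta.BlockPoincare (avg variance dirichlet pathSrc pathTgt)
open B4Block227 (poincare_path8)

variable {d L : ℕ}

/-! ## §1  The one-dimensional Poincaré inequality in the `PathIneq` format -/

/-- The bond form of a profile on [0, L): Σ_{a<L, a+1<L} (u(a+1) − u(a))² = Σ_{s<L−1} (u(s+1) − u(s))². [folklore] -/
theorem bond_sum_eq (hL : 1 ≤ L) (u : ℤ → ℝ) :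
    ∑ a ∈ Ico (0 : ℤ) (L : ℤ), (if a + 1 < (L : ℤ) then (u (a + 1) - u a) ^ 2 else 0) =
      ∑ s ∈ range (L - 1), (u ((s : ℤ) + 1) - u s) ^ 2 := by
  rw [sum_Ico_int_eq_sum_range]
  obtain ⟨K, rfl⟩ : ∃ K, L = K + 1 := ⟨L - 1, by omega⟩
  rw [sum_range_succ, if_neg (by push_cast; omega), add_zero, show K + 1 - 1 = K by omega]
  refine sum_congr rfl fun n hn => ?_
  have := mem_range.1 hn
  rw [if_pos (by push_cast; omega)]

/-- Transport of `B4Block227.poincare_path8` (canonical paths on `Fin L`, constant L²/8) to profiles `u : ℤ → ℝ` on [0, L):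
Σ_{[0,L)} (u − ū)² ≤ (L²/8) Σ_{a+1<L} (u(a+1) − u(a))². [folklore] -/
theorem var_le (hL : 1 ≤ L) (u : ℤ → ℝ) :
    ∑ a ∈ Ico (0 : ℤ) (L : ℤ), (u a - (∑ b ∈ Ico (0 : ℤ) (L : ℤ), u b) / (L : ℝ)) ^ 2 ≤
      (L : ℝ) ^ 2 / 8 * ∑ a ∈ Ico (0 : ℤ) (L : ℤ), (if a + 1 < (L : ℤ) then (u (a + 1) - u a) ^ 2 else 0) := by
  obtain ⟨n, rfl⟩ : ∃ n, L = n + 1 := ⟨L - 1, by omega⟩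
  have h := poincare_path8 n (fun i : Fin (n + 1) => u i)
  have hv : variance (fun i : Fin (n + 1) => u i) =
      ∑ a ∈ Ico (0 : ℤ) ((n + 1 : ℕ) : ℤ), (u a - (∑ b ∈ Ico (0 : ℤ) ((n + 1 : ℕ) : ℤ), u b) / ((n + 1 : ℕ) : ℝ)) ^ 2 := by
    unfold variance avg
    rw [card_univ, Fintype.card_fin, sum_Ico_int_eq_sum_range, sum_Ico_int_eq_sum_range,
      ← Fin.sum_univ_eq_sum_range (fun i : ℕ => u i) (n + 1),
      ← Fin.sum_univ_eq_sum_range (fun i : ℕ => (u i - (∑ b : Fin (n + 1), u b) / ((n + 1 : ℕ) : ℝ)) ^ 2) (n + 1)]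
  have hd : dirichlet (pathSrc n) (pathTgt n) (fun i : Fin (n + 1) => u i) =
      ∑ a ∈ Ico (0 : ℤ) ((n + 1 : ℕ) : ℤ), (if a + 1 < ((n + 1 : ℕ) : ℤ) then (u (a + 1) - u a) ^ 2 else 0) := by
    rw [bond_sum_eq (by omega), show n + 1 - 1 = n by omega,
      ← Fin.sum_univ_eq_sum_range (fun s : ℕ => (u ((s : ℤ) + 1) - u s) ^ 2) n]
    unfold dirichlet pathSrc pathTgt
    refine sum_congr rfl fun k _ => ?_
    simp [Fin.val_succ]
  rw [hv, hd] at h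
  have e : (((n + 1 : ℕ) : ℝ)) ^ 2 / 8 = ((n : ℝ) + 1) ^ 2 / 8 := by push_cast; ring
  rw [e]; exact h


/-! ## §2  The path inequality for κ ≤ min(1, 8/L) -/

/-- **`PathIneq L κ` for every κ ≤ 1 with κL ≤ 8** (L ≥ 1). [folklore] -/
theorem pathIneq_of_mul_le (hL : 1 ≤ L) {κ : ℝ} (hκ1 : κ ≤ 1) (hκ : κ * (L : ℝ) ≤ 8) : PathIneq L κ := by
  intro u
  have hL0 : (0 : ℝ) < L := by exact_mod_cast hL
  set S : ℝ := ∑ b ∈ Ico (0 : ℤ) (L : ℤ), u b with hS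
  set A : ℝ := S / (L : ℝ) with hA
  set T : ℝ := ∑ a ∈ Ico (0 : ℤ) (L : ℤ), (if a + 1 < (L : ℤ) then (u (a + 1) - u a) ^ 2 else 0) with hT
  have hT0 : 0 ≤ T := sum_nonneg fun a _ => by split_ifs <;> positivity
  have hvar := sum_sq_eq_var_add L u A (by rw [hA, hS]; field_simp)
  have hV := var_le hL u
  rw [← hS, ← hA, ← hT] at hV
  have hV0 : 0 ≤ ∑ a ∈ Ico (0 : ℤ) (L : ℤ), (u a - A) ^ 2 := sum_nonneg fun a _ => sq_nonneg _
  have hS2 : S ^ 2 / (L : ℝ) = (L : ℝ) * A ^ 2 := by rw [hA]; field_simp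
  rw [hvar, hS2]
  rcases le_or_gt κ 0 with hκ0 | hκ0
  · nlinarith [mul_nonneg hL0.le (sq_nonneg A)]
  · have hκC : κ * ((L : ℝ) ^ 2 / 8) ≤ L := by nlinarith [mul_le_mul_of_nonneg_right hκ hL0.le]
    nlinarith [mul_le_mul_of_nonneg_right hκC hT0, mul_nonneg hL0.le (sq_nonneg A),
      mul_le_mul_of_nonneg_left hV hκ0.le]

/-! ## §3  The layer constant in every dimension: the window [8/L, 12/(L+1)] -/

/-- **Every κ ≤ 1 with κL ≤ 8 is admissible in every dimension d ≥ 2** (L ≥ 1). [folklore] -/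
theorem layerIneq_of_mul_le (hd : 2 ≤ d) (hL : 1 ≤ L) {κ : ℝ} (hκ1 : κ ≤ 1) (hκ : κ * (L : ℝ) ≤ 8) :
    LayerIneq d L κ :=
  (layerIneq_iff_pathIneq hd hL κ).2 (pathIneq_of_mul_le hL hκ1 hκ)

/-- In particular `LayerIneq d L (8/L)` for every d ≥ 2 and L ≥ 8. [folklore] -/
theorem layerIneq_eight_div (hd : 2 ≤ d) (hL : 8 ≤ L) : LayerIneq d L (8 / (L : ℝ)) := by
  have hL8 : (8 : ℝ) ≤ L := by exact_mod_cast hL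
  have hpos : (0 : ℝ) < (L : ℝ) := by positivity
  refine layerIneq_of_mul_le hd (by omega) ?_ (le_of_eq (div_mul_cancel₀ _ hpos.ne'))
  rw [div_le_one hpos]; exact hL8

/-- The dimension-free admissible constant for every L ≥ 1: `LayerIneq d L (min 1 (8/L))` (d ≥ 2). [folklore] -/
theorem layerIneq_lower (hd : 2 ≤ d) (hL : 1 ≤ L) : LayerIneq d L (min 1 (8 / (L : ℝ))) := by
  have hpos : (0 : ℝ) < (L : ℝ) := by exact_mod_cast hL
  refine layerIneq_of_mul_le hd hL (min_le_left _ _) ?_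
  calc min 1 (8 / (L : ℝ)) * (L : ℝ) ≤ 8 / (L : ℝ) * (L : ℝ) :=
        mul_le_mul_of_nonneg_right (min_le_right _ _) hpos.le
    _ = 8 := div_mul_cancel₀ _ hpos.ne'

/-- The new constant dominates κ₁ = 2/(2 + (d−1)(L−1)) of `B6LayerPoincarePair` (d ≥ 2, L ≥ 1). [folklore] -/
theorem kappa1_le_eight_div (hd : 2 ≤ d) (hL : 1 ≤ L) : kappa1 d L ≤ 8 / (L : ℝ) := by
  have hd' : (2 : ℝ) ≤ d := by exact_mod_cast hd
  have hL' : (1 : ℝ) ≤ L := by exact_mod_cast hL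
  have hden : (0 : ℝ) < 2 + ((d : ℝ) - 1) * ((L : ℝ) - 1) := by nlinarith
  rw [kappa1, div_le_div_iff₀ hden (by positivity)]
  nlinarith [mul_nonneg (sub_nonneg.2 hd') (sub_nonneg.2 hL')]

/-- **The d-independent window.**  For every d ≥ 2 and L ≥ 8: 8/L is admissible and no admissible constant
exceeds 12/(L+1) (`B6LayerUpperBound.layerIneq_le`). [folklore] -/
theorem optimal_window (hd : 2 ≤ d) (hL : 8 ≤ L) :
    LayerIneq d L (8 / (L : ℝ)) ∧ ∀ κ : ℝ, LayerIneq d L κ → κ ≤ 12 / ((L : ℝ) + 1) :=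
  ⟨layerIneq_eight_div hd hL, fun _ h => layerIneq_le hd (by omega) h⟩

/-- The window's ratio: 12/(L+1) < (3/2) · (8/L) (L ≥ 1). [folklore] -/
theorem window_ratio_lt (hL : 1 ≤ L) : 12 / ((L : ℝ) + 1) < 3 / 2 * (8 / (L : ℝ)) := by
  have hL1 : (1 : ℝ) ≤ L := by exact_mod_cast hL
  rw [show (3 : ℝ) / 2 * (8 / (L : ℝ)) = 12 / (L : ℝ) by field_simp; ring]
  exact div_lt_div_of_pos_left (by norm_num) (by positivity) (by linarith)

/-- Summary for the L of the paper (L ≥ 10, where the printed factor 1 fails, `B6LayerTensor.layerIneq_one_iff'`):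
in every dimension d ≥ 2 the sentence holds with 8/L in place of 1 and fails with any κ > 12/(L+1). [folklore] -/
theorem large_L_summary (hd : 2 ≤ d) (hL : 10 ≤ L) :
    ¬ LayerIneq d L 1 ∧ LayerIneq d L (8 / (L : ℝ)) ∧
      ∀ κ : ℝ, 12 / ((L : ℝ) + 1) < κ → ¬ LayerIneq d L κ :=
  ⟨(B6LayerTensor.layerIneq_one_iff' hd).not.2 (by omega), layerIneq_eight_div hd (by omega),
    fun _ hκ h => (not_le.2 hκ) (layerIneq_le hd (by omega) h)⟩

end Literature.MathematicalPhysics.QuantumFieldTheory.Balaban1983to89.B6LayerWindow
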